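import Summits.KontsevichZagierPeriods.KontsevichZagierPeriods.Theses.AbelContraction
import Summits.KontsevichZagierPeriods.KontsevichZagierPeriods.Theorems.RealOnePeriodRelations.Negative.Saturation

/-!
# `TorsionFreeBudget`: the truncated relations `KZ.relationsLE d` are saturated

Item stmt-KontsevichZagierPeriods-12477 (route AbelContraction, support `TorsionFreeBudget`):
for every dimension budget `d`, every `n ≠ 0` and every formal combination `x` of integral
representations, `n • x ∈ KZ.relationsLE d → x ∈ KZ.relationsLE d`; in words, the quotient
`FormalRep ⧸ relationsLE d` (and with it the truncated calculus `K_≤d = formalRepLE d ⧸ relationsLE d`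
of route DimensionBudget) is torsion-free, so rational certificates inside a dimension budget may be
cleared of denominators (the factor `2` of the two branches of an oval in the engine of the route).

Proof.
1. *Purity of the dimension filtration.* A truncation endomorphism `T` of the free abelian group
   `FormalRep` (a generator `[s]` is kept if `dim s ≤ d` and sent to `0` otherwise; one exists by
   the universal property `FreeAbelianGroup.lift`) takes values in `formalRepLE d` and fixes it
   pointwise; since `FormalRep` is torsion-free (`FreeAbelianGroup.support_nsmul`),
   `n • x ∈ formalRepLE d` with `n ≠ 0` forces `T x = x`, i.e. `x ∈ formalRepLE d`
   (`mem_formalRepLE_of_nsmul_mem`).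
2. *Division by `n` is a derived rule of integrand additivity.* With `h = KZ.scale (n⁻¹)` (the
   scaling endomorphism of `KZRelationsLE`), `x − n • h x` lies in the subgroup generated by the
   integrand-additivity moves (1b) alone — the tree's divisibility identity
   `RealOnePeriodRelationsNegative.sub_nsmul_scale_inv_mem` (Theorems/RealOnePeriodRelations/
   Negative/Saturation.lean, built on `KZ.IntegralRep.of_constMul_nat_sub_nsmul_mem`:
   `[σ, n f] − n•[σ, f] ∈ closure (1b)` and the instance `[σ, f] − [σ, n·(n⁻¹ f)] − [σ, 0·f] ∈ (1b)`).
3. *Homogeneity of (1b).* A (1b) instance involves three representations of one dimension, so `T`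
   maps it to itself — then it is a move supported in dimension `≤ d` — or to `0`; hence `T` maps
   `closure (1b)` into `relationsLE d`. As `x` and `h x` lie in `formalRepLE d`, `T` fixes
   `x − n • h x`, which therefore lies in `relationsLE d`; and `x = (x − n • h x) + h (n • x)` with
   `h (n • x) ∈ relationsLE d` because `h` preserves every `relationsLE d`
   (`KZ.scale_mem_relationsLE`).

References: M. Kontsevich, D. Zagier, *Periods*, in: Mathematics Unlimited — 2001 and Beyond
(2001), §1.2, rules (1)–(3); the truncation `relationsLE d` is the construction of
`Literature/NumberTheory/Transcendental/KZRelationsLE.lean`; step 2 is imported from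
`Theorems/RealOnePeriodRelations/Negative/Saturation.lean` (route SymplecticScissors, same summit).
-/

noncomputable section

open Literature.NumberTheory.Transcendental Literature.NumberTheory.Transcendental.KZ
open Summit.KontsevichZagierPeriods.SymplecticScissors.RealOnePeriodRelationsNegative
  (isAlgebraic_inv_nat sub_nsmul_scale_inv_mem)

namespace Summit.KontsevichZagierPeriods.AbelContraction.TorsionFreeBudget

/-! ## Truncation endomorphisms and purity of `formalRepLE d` -/

/-- A truncation endomorphism in dimension `≤ d` (keep the generators of dimension `≤ d`, kill the
others) takes values in `formalRepLE d`. [cite: KontsevichZagier2001, §1.2 Problem 2] -/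
theorem truncation_mem_formalRepLE {d : ℕ} (T : FormalRep →+ FormalRep)
    (hT : ∀ (k : ℕ) (s : IntegralRep k), T (of s) = if k ≤ d then of s else 0) (x : FormalRep) :
    T x ∈ formalRepLE d := by
  induction x using FreeAbelianGroup.induction_on with
  | zero => rw [map_zero]; exact zero_mem _
  | of σ =>
    obtain ⟨k, s⟩ := σ
    change T (of s) ∈ formalRepLE d
    rw [hT]
    split_ifs with hk
    · exact of_mem_formalRepLE s hk
    · exact zero_mem _
  | neg σ ih => rw [map_neg]; exact neg_mem ih
  | add x y hx hy => rw [map_add]; exact add_mem hx hy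

/-- A truncation endomorphism in dimension `≤ d` fixes `formalRepLE d` pointwise (it fixes its
generators). [cite: KontsevichZagier2001, §1.2 Problem 2] -/
theorem truncation_eq_self_of_mem {d : ℕ} (T : FormalRep →+ FormalRep)
    (hT : ∀ (k : ℕ) (s : IntegralRep k), T (of s) = if k ≤ d then of s else 0) {x : FormalRep}
    (hx : x ∈ formalRepLE d) : T x = x := by
  have h : Set.EqOn T (AddMonoidHom.id FormalRep)
      {x : FormalRep | ∃ (k : ℕ) (s : IntegralRep k), k ≤ d ∧ x = of s} := by
    rintro _ ⟨k, s, hk, rfl⟩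
    rw [hT, if_pos hk, AddMonoidHom.id_apply]
  exact AddMonoidHom.eqOn_closure h hx

/-- **Purity of the dimension filtration**: `formalRepLE d` is a pure subgroup of the free abelian
group `FormalRep` — if `n • x` is supported in dimension `≤ d` and `n ≠ 0`, so is `x`. (Apply a
truncation endomorphism `T`: `n • (T x − x) = T (n • x) − n • x = 0`, and `FormalRep` is
torsion-free.) [cite: KontsevichZagier2001, §1.2 Problem 2] -/
theorem mem_formalRepLE_of_nsmul_mem {d n : ℕ} (hn : n ≠ 0) {x : FormalRep}
    (hx : n • x ∈ formalRepLE d) : x ∈ formalRepLE d := by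
  let T : FormalRep →+ FormalRep :=
    FreeAbelianGroup.lift fun σ : Σ k, IntegralRep k => if σ.1 ≤ d then of σ.2 else 0
  have hT : ∀ (k : ℕ) (s : IntegralRep k), T (of s) = if k ≤ d then of s else 0 :=
    fun k s => FreeAbelianGroup.lift_apply_of _ _
  have h1 : n • (T x - x) = 0 := by
    rw [nsmul_sub, ← map_nsmul, truncation_eq_self_of_mem T hT hx, sub_self]
  have h2 : T x - x = 0 := by
    have h := FreeAbelianGroup.support_nsmul n hn (T x - x)
    rw [h1, FreeAbelianGroup.support_zero] at h
    exact FreeAbelianGroup.support_eq_empty.mp h.symm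
  rw [← sub_eq_zero.mp h2]
  exact truncation_mem_formalRepLE T hT x

/-! ## Truncation maps the integrand-additivity subgroup into `relationsLE d` -/

/-- **Homogeneity of integrand additivity**: an integrand-additivity instance `[r] − [r₁] − [r₂]`
involves three representations of one dimension `k`, so a truncation endomorphism in dimension
`≤ d` sends it to itself (if `k ≤ d`: a move supported in dimension `≤ d`) or to `0` (if `k > d`);
hence it maps the subgroup generated by the (1b) moves into `relationsLE d`.
[cite: KontsevichZagier2001, §1.2 rule (1)] -/
theorem truncation_mem_relationsLE_of_mem_closure_integrandAddRel {d : ℕ}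
    (T : FormalRep →+ FormalRep)
    (hT : ∀ (k : ℕ) (s : IntegralRep k), T (of s) = if k ≤ d then of s else 0) {c : FormalRep}
    (hc : c ∈ AddSubgroup.closure integrandAddRel) : T c ∈ relationsLE d := by
  have h : AddSubgroup.closure integrandAddRel ≤ (relationsLE d).comap T := by
    refine (AddSubgroup.closure_le _).mpr ?_
    rintro _ ⟨k, r, r₁, r₂, h₁, h₂, hadd, rfl⟩
    simp only [AddSubgroup.coe_comap, Set.mem_preimage, SetLike.mem_coe, map_sub, hT]
    by_cases hk : k ≤ d
    · simp only [if_pos hk]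
      exact movesLE_subset_relationsLE d
        ⟨Or.inl (Or.inl (Or.inr ⟨k, r, r₁, r₂, h₁, h₂, hadd, rfl⟩)),
          sub_mem (sub_mem (of_mem_formalRepLE r hk) (of_mem_formalRepLE r₁ hk))
            (of_mem_formalRepLE r₂ hk)⟩
    · simp only [if_neg hk, sub_zero]
      exact zero_mem _
  exact h hc

/-! ## Saturation of `relationsLE d` -/

/-- **The truncated relations are saturated**: `n • x ∈ relationsLE d` with `n ≠ 0` implies
`x ∈ relationsLE d`. (`x ∈ formalRepLE d` by purity; `x − n • h x ∈ closure (1b)` for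
`h = scale (n⁻¹)` is fixed by the truncation, hence lies in `relationsLE d`; and
`n • h x = h (n • x) ∈ relationsLE d`.) [cite: KontsevichZagier2001, §1.2] -/
theorem mem_relationsLE_of_nsmul_mem {d n : ℕ} (hn : n ≠ 0) {x : FormalRep}
    (hx : n • x ∈ relationsLE d) : x ∈ relationsLE d := by
  let T : FormalRep →+ FormalRep :=
    FreeAbelianGroup.lift fun σ : Σ k, IntegralRep k => if σ.1 ≤ d then of σ.2 else 0
  have hT : ∀ (k : ℕ) (s : IntegralRep k), T (of s) = if k ≤ d then of s else 0 :=
    fun k s => FreeAbelianGroup.lift_apply_of _ _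
  have hxF : x ∈ formalRepLE d :=
    mem_formalRepLE_of_nsmul_mem hn (relationsLE_le_formalRepLE d hx)
  have h1 : n • scale ((n : ℝ)⁻¹) (isAlgebraic_inv_nat n) x ∈ relationsLE d := by
    rw [← map_nsmul]
    exact scale_mem_relationsLE _ _ hx
  have h2 : T (x - n • scale ((n : ℝ)⁻¹) (isAlgebraic_inv_nat n) x) =
      x - n • scale ((n : ℝ)⁻¹) (isAlgebraic_inv_nat n) x := by
    rw [map_sub, map_nsmul, truncation_eq_self_of_mem T hT hxF,
      truncation_eq_self_of_mem T hT (scale_mem_formalRepLE _ _ hxF)]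
  have h3 : x - n • scale ((n : ℝ)⁻¹) (isAlgebraic_inv_nat n) x ∈ relationsLE d := by
    rw [← h2]
    exact truncation_mem_relationsLE_of_mem_closure_integrandAddRel T hT
      (sub_nsmul_scale_inv_mem n hn x)
  simpa using add_mem h3 h1

/-- **Item `TorsionFreeBudget` (stmt-KontsevichZagierPeriods-12477)**: the truncated relations of
the Kontsevich–Zagier calculus are saturated — `n ≠ 0` and `n • x ∈ KZ.relationsLE d` imply
`x ∈ KZ.relationsLE d`. [cite: KontsevichZagier2001, §1.2] -/
theorem torsionFreeBudget_proof :
    Summit.KontsevichZagierPeriods.KontsevichZagierPeriods.Theses.AbelContraction.TorsionFreeBudget := by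
  unfold Summit.KontsevichZagierPeriods.KontsevichZagierPeriods.Theses.AbelContraction.TorsionFreeBudget
  intro d n x hn hx
  exact mem_relationsLE_of_nsmul_mem hn hx

end Summit.KontsevichZagierPeriods.AbelContraction.TorsionFreeBudget
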